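import Summits.QuantumFields.QCD.Theses.EulerDescent

/-!
# Crux attack on `EulerDescent.HonestHeavyAnchor` (stmt-QuantumFields-16901) — structural lemmas

Refuter seat `refuter-rattack-stmt-QuantumFields-16901-0`, 2026-08-17 (mode crux-attack, one cycle).
Everything here is sorry-free; no lemma asserts a Theses decl positively.

* `corner_commits` — the corner clause `IsLUB NonMassive(β_k) (mc k)` commits the witness, for all
  large `k`, to (i) a NON-MASSIVE degenerate bare mass at `β_k` (a phase-transition point on the Wilson
  axis at every large inverse coupling of an AF sequence) and (ii) massiveness of EVERY degenerate theory
  above `mc k` (contains clustering of the heavy-quark / pure-gauge sector at fixed weak coupling):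
  the clause is physics-hard in both directions, so neither a junk proof nor a junk refutation exists.
* `thresholdQCD_of` — `HonestHeavyAnchor → HeavyThresholdYMBridge.ThresholdQCD` (stmt-QuantumFields-8794):
  the crux is at least as strong as the heavy-threshold family's target (YM-hard), by `M₀ := M_h`.
* `hasAsymptoticScaling_of_body` — conjunct 4 of the crux is implied by conjunct 7 (redundant, harmless).
* `branch_weak_of_body` — the body alone gives `−1 < m_crit(k) + a_k M_h/Z_m(k)` eventually; the branch
  conjunct `−1 < m_crit(k)` is independent only through the vanishing term `a_k M_h/Z_m(k)`.
* `body_above_corner` — pin + `M_h > 0` put every heavy bare trajectory strictly ABOVE the corner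
  eventually, i.e. (with `corner_commits`) on the massive side: corner and lattice-gap clauses cannot be
  played against each other (internal consistency of the crux).
* `shell_trivial` — TEETH MAP: without corner/pin, non-triviality and lattice gap the shell is junk-provable
  (`canonicalAF`, `z ≡ 0`, vacuum data), so exactly those clauses carry the content.
* junk witness: the vacuum OS data (which inhabit `IsQCDAlong` along `z ≡ 0` and have every mass gap)
  fail `IsNontrivial glue` — the body is not junk-closable (known: `OSData.not_isNontrivial_vacuum`).
-/

namespace Summit.QuantumFields.QCD.Cruxes.HonestHeavyAnchor.CruxAttack

open Filter Topology
open Literature.MathematicalPhysics.QuantumFieldTheory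
open Summit.QuantumFields.QCD.Theses

variable {Nf : ℕ}

variable (Nf) in
/-- The crux's inlined set of NON-MASSIVE degenerate bare Wilson masses at inverse coupling `β`
(verbatim the set under `IsLUB` in `HonestHeavyAnchor`). -/
def NonMassive (β : ℝ) : Set ℝ :=
  {μ : ℝ | ¬ (∀ (R R' : ℕ) (A : QCDLatticeObservable Nf R) (B : QCDLatticeObservable Nf R'),
    ∃ (C δ : ℝ) (S₀ : ℕ), 0 < δ ∧ ∀ S : ℕ, S₀ ≤ S → ∀ n : ℕ, n ≤ S →
      ‖qcdLatticeConnectedCorr β (2 * S + 1) (fun _ : Fin Nf => μ) A B n‖ ≤ C * Real.exp (-(δ * n)))}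

/-- **What the corner clause commits the witness to**: eventually the non-massive set at `β_k` is
non-empty (a transition point exists on the Wilson mass axis at coupling `β_k`), bounded above, and
every degenerate bare mass strictly above `mc k` is massive. [folklore] -/
theorem corner_commits (reg : QCDRegularisation Nf) (mc : ℕ → ℝ)
    (h : ∀ᶠ k in atTop, IsLUB (NonMassive Nf (reg.β k)) (mc k)) :
    ∀ᶠ k in atTop, (NonMassive Nf (reg.β k)).Nonempty ∧ BddAbove (NonMassive Nf (reg.β k)) ∧
      ∀ μ : ℝ, mc k < μ → μ ∉ NonMassive Nf (reg.β k) :=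
  h.mono fun _ hk => ⟨hk.nonempty, hk.bddAbove, fun _ hμ hmem => (not_lt.2 (hk.1 hmem)) hμ⟩

/-- The corner clause of `HonestHeavyAnchor` is literally `∀ᶠ k, IsLUB (NonMassive Nf (reg.β k)) (mc k)`,
so the crux implies, for `N_f = 2`, an asymptotically scaling coupling sequence with a non-massive
degenerate bare mass at every large step. [folklore] -/
theorem exists_nonMassive_of (h : EulerDescent.HonestHeavyAnchor) :
    ∃ reg : QCDRegularisation 2, (reg.scheme 0 0 0).HasAsymptoticScaling ∧
      ∀ᶠ k in atTop, (NonMassive 2 (reg.β k)).Nonempty ∧ BddAbove (NonMassive 2 (reg.β k)) := by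
  obtain ⟨reg, mc, Mh, hcorner, -, -, haf, -⟩ := h 2 (Or.inl rfl)
  exact ⟨reg, haf, (corner_commits reg mc hcorner).mono fun k hk => ⟨hk.1, hk.2.1⟩⟩

/-- VERBATIM the statement of `HeavyThresholdYMBridge.ThresholdQCD` (item stmt-QuantumFields-8794; restated, not
imported, so that this workfile depends on `Theses.EulerDescent` only — same normalised signature; in the seat's
folder the by-name version `HonestHeavyAnchor → HeavyThresholdYMBridge.ThresholdQCD` is checked in `Attack.lean`). -/
def ThresholdQCDShape : Prop :=
  ∀ Nf : ℕ, Nf = 2 ∨ Nf = 3 → ∃ M₀ : ℝ, 0 ≤ M₀ ∧ ∃ reg : QCDRegularisation Nf, reg.HasMassScaling ∧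
    ∀ m : Fin Nf → ℝ, (∀ f, M₀ < m f) →
      ∃ (z shift : QCDField Nf → ℕ → ℝ) (T : OSData (QCDField Nf) 4),
        IsQCDAlong (reg.scheme m z shift) T ∧ T.IsNontrivial QCDField.glue ∧
          T.IsNonGaussian QCDField.glue ∧
            (∀ f g : Fin Nf, f ≠ g → T.IsNontrivial (QCDField.pseudoRe f g)) ∧
              ∃ Δ > 0, T.HasMassGap Δ ∧ (reg.scheme m z shift).HasLatticeMassGap Δ

/-- **The crux is at least the heavy-threshold target**: `HonestHeavyAnchor → ThresholdQCD`
(stmt-QuantumFields-8794, verbatim shape), with `M₀ := M_h`. [folklore] -/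
theorem thresholdQCD_of (h : EulerDescent.HonestHeavyAnchor) : ThresholdQCDShape := by
  intro Nf hNf
  obtain ⟨reg, mc, Mh, -, -, hms, -, -, hMh, hbody⟩ := h Nf hNf
  exact ⟨Mh, hMh.le, reg, hms, fun m hm => hbody m fun f => (hm f).le⟩

/-- **Redundancy**: the asymptotic-scaling conjunct follows from the body conjunct (it reads only
`β_k, a_k`, which `reg.scheme m z shift` shares with `reg.scheme 0 0 0`). [folklore] -/
theorem hasAsymptoticScaling_of_body (reg : QCDRegularisation Nf) (Mh : ℝ)
    (hbody : ∀ m : Fin Nf → ℝ, (∀ f, Mh ≤ m f) →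
      ∃ (z shift : QCDField Nf → ℕ → ℝ) (T : OSData (QCDField Nf) 4),
        IsQCDAlong (reg.scheme m z shift) T ∧ T.IsNontrivial QCDField.glue ∧ T.IsNonGaussian QCDField.glue ∧
        (∀ f g : Fin Nf, f ≠ g → T.IsNontrivial (QCDField.pseudoRe f g)) ∧
        ∃ Δ > 0, T.HasMassGap Δ ∧ (reg.scheme m z shift).HasLatticeMassGap Δ) :
    (reg.scheme 0 0 0).HasAsymptoticScaling := by
  obtain ⟨z, shift, T, hq, -⟩ := hbody (fun _ => Mh) (fun _ => le_rfl)
  exact hq.1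

/-- **The branch conjunct is almost implied by the body**: `IsQCDAlong` at the tuple `m ≡ M_h` gives
`−1 < m_crit(k) + a_k M_h / Z_m(k)` eventually. [folklore] -/
theorem branch_weak_of_body (reg : QCDRegularisation Nf) (Mh : ℝ) (f : Fin Nf)
    (hbody : ∀ m : Fin Nf → ℝ, (∀ f, Mh ≤ m f) →
      ∃ (z shift : QCDField Nf → ℕ → ℝ) (T : OSData (QCDField Nf) 4),
        IsQCDAlong (reg.scheme m z shift) T ∧ T.IsNontrivial QCDField.glue ∧ T.IsNonGaussian QCDField.glue ∧
        (∀ f g : Fin Nf, f ≠ g → T.IsNontrivial (QCDField.pseudoRe f g)) ∧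
        ∃ Δ > 0, T.HasMassGap Δ ∧ (reg.scheme m z shift).HasLatticeMassGap Δ) :
    ∀ᶠ k in atTop, (-1 : ℝ) < reg.mcrit k + reg.a k * Mh / reg.Zm k := by
  obtain ⟨z, shift, T, hq, -⟩ := hbody (fun _ => Mh) (fun _ => le_rfl)
  simpa using hq.2.1 f

/-- **Pin + positive threshold put the heavy trajectories above the corner**: eventually
`mc k < m_crit(k) + a_k m_f / Z_m(k)` for every `m_f ≥ M_h > 0`. [folklore] -/
theorem body_above_corner (reg : QCDRegularisation Nf) (mc : ℕ → ℝ) (Mh : ℝ) (hMh : 0 < Mh)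
    (hpin : Tendsto (fun k => (reg.mcrit k - mc k) * reg.Zm k / reg.a k) atTop (𝓝 0))
    (m : Fin Nf → ℝ) (hm : ∀ f, Mh ≤ m f) (f : Fin Nf) :
    ∀ᶠ k in atTop, mc k < reg.mcrit k + reg.a k * m f / reg.Zm k := by
  have h1 : ∀ᶠ k in atTop, -(Mh / 2) < (reg.mcrit k - mc k) * reg.Zm k / reg.a k :=
    hpin.eventually_const_lt (by linarith)
  filter_upwards [h1] with k hk
  have ha := reg.a_pos k
  have hZ := reg.Zm_pos k
  rw [lt_div_iff₀ ha] at hk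
  rw [← sub_lt_iff_lt_add', lt_div_iff₀ hZ]
  have h2 : (mc k - reg.mcrit k) * reg.Zm k < reg.a k * (Mh / 2) := by nlinarith
  have h3 : reg.a k * (Mh / 2) ≤ reg.a k * m f :=
    mul_le_mul_of_nonneg_left (by linarith [hm f]) ha.le
  linarith

/-- With the corner clause, the heavy trajectories therefore sit eventually at MASSIVE degenerate bare
masses — consistent with (not against) the body's `HasLatticeMassGap`. [folklore] -/
theorem body_on_massive_side (reg : QCDRegularisation Nf) (mc : ℕ → ℝ) (Mh : ℝ) (hMh : 0 < Mh)
    (hcorner : ∀ᶠ k in atTop, IsLUB (NonMassive Nf (reg.β k)) (mc k))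
    (hpin : Tendsto (fun k => (reg.mcrit k - mc k) * reg.Zm k / reg.a k) atTop (𝓝 0))
    (M : ℝ) (hM : Mh ≤ M) (f : Fin Nf) :
    ∀ᶠ k in atTop, reg.mcrit k + reg.a k * M / reg.Zm k ∉ NonMassive Nf (reg.β k) := by
  filter_upwards [corner_commits reg mc hcorner,
    body_above_corner reg mc Mh hMh hpin (fun _ => M) (fun _ => hM) f] with k hk hlt
  exact hk.2.2 _ hlt

/-- **Teeth map (dual of `_false_without_`)**: drop the corner/pin, the three non-triviality clauses and
the lattice gap, and the remaining shell of `HonestHeavyAnchor` (mass scaling, asymptotic scaling, branch,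
threshold, `IsQCDAlong` + continuum `HasMassGap`) is JUNK-PROVABLE for every `N_f` — witness
`canonicalAF`, `z ≡ 0`, vacuum OS data. So the content of the crux sits exactly in: the corner (both
halves), `IsNontrivial`/`IsNonGaussian`/`pseudoRe` (jointly with `IsQCDAlong`), and `HasLatticeMassGap`. [folklore] -/
theorem shell_trivial (Nf : ℕ) :
    ∃ (reg : QCDRegularisation Nf) (Mh : ℝ), reg.HasMassScaling ∧ (reg.scheme 0 0 0).HasAsymptoticScaling ∧
      (∀ᶠ k in atTop, (-1 : ℝ) < reg.mcrit k) ∧ 0 < Mh ∧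
      ∀ m : Fin Nf → ℝ, (∀ f, Mh ≤ m f) →
        ∃ (z shift : QCDField Nf → ℕ → ℝ) (T : OSData (QCDField Nf) 4),
          IsQCDAlong (reg.scheme m z shift) T ∧ ∃ Δ > 0, T.HasMassGap Δ := by
  refine ⟨QCDRegularisation.canonicalAF Nf, 1, QCDRegularisation.canonicalAF_hasMassScaling,
    QCDScheme.zeroAF_hasAsymptoticScaling, ?_, one_pos, ?_⟩
  · exact Eventually.of_forall fun k => by norm_num [QCDRegularisation.canonicalAF]
  · intro m hm
    refine ⟨0, 0, OSData.vacuum _ 4, ⟨QCDScheme.zeroAF_hasAsymptoticScaling, ?_, ?_⟩, 1, one_pos,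
      OSData.vacuum_hasMassGap 1⟩
    · intro fl
      refine Eventually.of_forall fun k => ?_
      have hpos : 0 < (QCDRegularisation.canonicalAF Nf).a k * m fl / (QCDRegularisation.canonicalAF Nf).Zm k :=
        div_pos (mul_pos ((QCDRegularisation.canonicalAF Nf).a_pos k) (by linarith [hm fl]))
          ((QCDRegularisation.canonicalAF Nf).Zm_pos k)
      have h0 : (QCDRegularisation.canonicalAF Nf).mcrit k = 0 := rfl
      rw [QCDRegularisation.scheme_mq, h0, zero_add]
      linarith
    · intro n hn σ f F _ _
      have hS : (OSData.vacuum (QCDField Nf) 4).schwinger n σ F = 0 := by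
        simp [OSData.vacuum, Literature.MathematicalPhysics.AQFT.LabelledSchwingerFamily.trivial_of_ne_zero
          (QCDField Nf) hn]
      rw [hS]
      have hz : ∀ s k, ((QCDRegularisation.canonicalAF Nf).scheme m 0 0).z s k = 0 := fun _ _ => rfl
      refine tendsto_const_nhds.congr' (Eventually.of_forall fun k => ?_)
      obtain ⟨j, rfl⟩ := Nat.exists_eq_succ_of_ne_zero hn
      simp [qcdLatticeSchwinger, smearedInsertion, List.ofFn_succ, hz]

/-- Junk witness blocked: the vacuum data fail the glue non-triviality clause of the body. [folklore] -/
example (Nf : ℕ) : ¬ (OSData.vacuum (QCDField Nf) 4).IsNontrivial (QCDField.glue (Nf := Nf)) :=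
  OSData.not_isNontrivial_vacuum _

end Summit.QuantumFields.QCD.Cruxes.HonestHeavyAnchor.CruxAttack
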